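import Summits.ABC.IUTFork.Joshi.ArithTeichmullerAction
import Mathlib.NumberTheory.Padics.PadicIntegers
import Mathlib.Data.Set.Card
import HarnessLib

/-!
# Joshi's ATS I (arXiv:2106.11452v4) §5.11 (the category of PAIRS, Prop. 5.11.2, Def. 5.11.3), §5.20 (`|𝒳_{F,E}| = |𝒴_{F,E}|/φ^ℤ`,
# Thm. 5.20.1), §5.24 (Thm. 5.24.1: the action of `Aut_{ℤ_p}(Ĝ_m(𝒪_F))` BY CORRESPONDENCES on `𝔍(X,E)_F`) — typed over E-t1's carriers

Block E of the abc-iut cell (rung LADDER-ABC:A2.E; seat abc-iut-E-t21, slot T-48 of the [J-I] fan-out, E-plan-2 07:04:11Z; companion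
of `ATS1SpacesStructure` (§5.7–§5.10); inventory `plan/E/t21/INVENTORY-T48.tsv`). SOURCE: K. Joshi, *Construction of Arithmetic
Teichmüller Spaces I*, arXiv:2106.11452**v4** (UNREFEREED «Preliminary version»; bib `Joshi2021ATS1`; the series is rejected by the
IUT author, `Mochizuki2024JoshiReport`). Locators «p.N l.a–b» = PDF page N, lines of the cell's render
`plan/repair/lit/renders/Joshi-ATS1-2106.11452v4-PDFpaged-book-anonnd/pNNNN.txt`; node ids = v4 ids of plan/E/JOSHI-DAG.tsv. TAKES
NO SIDE on [IUTchIII] Cor. 3.12, on Joshi's claims, or on Mochizuki's report; typed ≠ proved; typed AS A CANDIDATE ≠ endorsed. What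
print ASSERTS is a `Prop`-valued `def` tagged `@[claim "Joshi2021ATS1" "disputed"]` (E-t1's registered key and status word), never an
axiom, instance, `sorry` or Literature fact; what FOLLOWS from the signatures is PROVED.

CARRIERS (imported BY NAME, never re-typed): E-t1's `Untilt`, `ATSObj X` (`Iso`, `self`, `embPadicComplex`, `relabel`),
`UntiltPoints p 𝒪E` (`Pt`, `untilt`, `frob`, `ptAct`, `Aut`, `ptEquiv`) and `ATSObjF X D` = objects of `𝔍(X,E)_F` over a point
(p428170, p429850).

WHAT IS TYPED. Def. 5.11.1 `ATS1.PairObj X` — pairs `(Y/E′, (E′ ↪ K, K♭ ≃ F))` with «anabelomorphic to `X/E`» = `Nonempty (Π^temp_Y ≃ₜ*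
Π^temp_X)` (no CHOSEN isomorphism: the geometric base-point, whose role in E-t1's typing is the label `α`, is omitted; tilt datum not
recorded, as in E-t1's `ATSObj`; (5) «`dim Y = dim X`» automatic on the curve interface) with `PairObj.Iso`; Prop. 5.11.2 (1)
`ATSObj.toPair` (forget the base-point), (2) `PairObj.withLabel`, (3)/Def. 5.11.3 (1) `PairObj.holDatum` = the datum `(Y/E′, E′ ↪ K)`
DETERMINING the morphism of `ℚ_p`-analytic spaces `Y^an_K → Y^an_{E′}` (READING: Berkovich spaces are not in the tree; E-t10's
`ArithHolStructure` of §4 is the structured counterpart — merge-debt), (4) = `withLabel`'s `α`; Def. 5.11.3 (2) `PairObj.overBase`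
(`𝔍(X,E)_E`) with «not an empty category» PROVED; §5.20 `UntiltPoints.XPoints` := `|𝒴_{F,E}|/φ^ℤ` ((5.20.2) is E-t1's `ptEquiv`);
Thm. 5.20.1 as claim shell `ATS1.Thm5201` — READING AT BIJECTION LEVEL, weaker than print (E-t1's `UntiltPoints` carries no topology
/ `G_E`-action on `|𝒴_{F,E}|`: merge-debt E-t1); Rmk. 5.20.4 recorded; Thm. 5.24.1: signature `ATS1.UnderlyingUntilt` for (2)
`τ : |𝒴_{F,E′}| → |𝒴_{F,ℚ_p}|`, the DIVISORIAL CORRESPONDENCE (5.24.2) `divCorrespondence` DEFINED over E-t1's `ptAct`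
(«`(Y/E′, y) ↦ ((Y/E′, y_j))_{j=1..m}`, `{y_j} = τ⁻¹(σ(τ y))`»), claims `TauFibreCard` ((3), [FF18 Prop. 2.3.20]) and
`AnabelomorphicDegreeEq` («`m = [E′:ℚ_p] = [E:ℚ_p]`»), and the count `ncard_divCorrespondence` DERIVED modulo `TauFibreCard`. E3 NOTE
(no test here): Joshi's v4 untilt-change move at the `ℚ_p`-level is SET-VALUED (one-to-many), not a group action on objects (contrast
Thm. 5.21.1 (6) = E-t1's `ATSObjF.act`, an honest action of `Aut_{𝒪_E}(𝒢(𝒪_F))`). Standard axioms only; sorry-free.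
-/

noncomputable section

open Set

namespace Summit.ABC.IUTFork.Joshi

open Literature.AnabelianGeometry.SemiGraphs (TemperedCurve)

variable {p : ℕ} [Fact p.Prime]

/-! ## 1. §5.11: the category of PAIRS `(Y/E′, (E′ ↪ K, K♭ ≃ F))` (no geometric base-point), Prop. 5.11.2, Def. 5.11.3 -/

namespace ATS1

variable (X : TemperedCurve p)

/-- **Def. 5.11.1** (J1:Def5.11.1, p.30 l.19–p.31 l.1; the render prints this second category also as «J(X,E)» — a different script
in the PDF, lost in the text layer): the category whose objects are PAIRS `(Y/E′, (E′ ↪ K, K♭ ≃ F))` with «(1) `E′` a p-adic field,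
(2) `F` some perfectoid field of characteristic `p > 0`, (3) `(E′ ↪ K, K♭ ≃ F)` an `E`-untilt of `F`, (4) `Y/E′` anabelomorphic to
`X/E`, (5) `dim(Y) = dim(X)`»; «Morphisms … are morphisms of the pairs». It «omits the geometric base-point `∗_K : 𝓜(K) → Y^an_E`»
(p.30 l.22–29), i.e. (in E-t1's typing, where the base-point's role is played by the LABEL `α`) it keeps only the EXISTENCE of a
tempered anabelomorphism. [claim: Joshi2021ATS1, status: disputed] -/
@[claim "Joshi2021ATS1" "disputed"]
structure PairObj : Type 1 where
  /-- the curve `Y/E′` with its tempered fundamental group (`E′ = Y.K` a p-adic field: (1)) -/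
  Y : TemperedCurve p
  /-- the algebraically closed perfectoid field `K` ((2)(3): an untilt) -/
  U : Untilt p
  /-- the embedding `E′ ↪ K` -/
  emb : Y.K →+* U.K
  /-- … continuous on `ℚ_p` -/
  continuous_emb : Continuous fun x : ℚ_[p] => emb (algebraMap ℚ_[p] Y.K x)
  /-- (4) `Y/E′` is anabelomorphic to `X/E`: SOME tempered isomorphism exists (no chosen one) -/
  anab : Nonempty (Y.PiTemp ≃ₜ* X.PiTemp)

namespace PairObj

variable {X}

/-- Morphisms of pairs (p.31 l.1: «morphisms of the pairs `(Y/E′, (E′ ↪ K, K♭ ≃ F))`»), READ like E-t1's `ATSObj.Iso` without the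
label clause: `E′ ≅ E′₁`, a topological `K ≅ K₁` compatible with the embeddings. [claim: Joshi2021ATS1, status: disputed] -/
structure Iso (P Q : PairObj X) : Type where
  /-- `E′ ≅ E′₁` -/
  baseEquiv : P.Y.K ≃+* Q.Y.K
  /-- `K ≅ K₁`, topologically -/
  fieldEquiv : P.U.TopEquiv Q.U
  /-- compatibility with the embeddings -/
  emb_comm : ∀ x, fieldEquiv.toRingEquiv (P.emb x) = Q.emb (baseEquiv x)

/-- "`P` and `Q` are isomorphic pairs". [claim: Joshi2021ATS1, status: disputed] -/
@[claim "Joshi2021ATS1" "disputed"]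
def IsIso (P Q : PairObj X) : Prop := Nonempty (Iso P Q)

/-- Every pair is isomorphic to itself. [folklore] -/
theorem IsIso.refl (P : PairObj X) : P.IsIso P := ⟨⟨RingEquiv.refl _, Untilt.TopEquiv.refl P.U, fun _ => rfl⟩⟩

/-- **Prop. 5.11.2 (2)** (p.31 l.8–15: «each choice of a geometric base-point … provides an object» of `𝔍(X,E)`; (4) p.31 l.22–29: a
base-point «gives tempered fundamental group `Π^temp_{Y/E′} (≃ Π^temp_{X/E})`»): a pair together with a LABEL `α` is an object of
`𝔍(X,E)`. [claim: Joshi2021ATS1, status: disputed] -/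
@[claim "Joshi2021ATS1" "disputed"]
def withLabel (P : PairObj X) (α : P.Y.PiTemp ≃ₜ* X.PiTemp) : ATSObj X := ⟨P.Y, P.U, P.emb, P.continuous_emb, α⟩

/-- The datum `(Y/E′, E′ ↪ K)` that DETERMINES the morphism of `ℚ_p`-analytic spaces `Y^an_K → Y^an_{E′}` of Prop. 5.11.2 (3) (p.31
l.16–21) = the «arithmetic holomorphic structure associated to the pair» of **Def. 5.11.3 (1)** (p.31 l.32–35). READING: Berkovich
spaces are not in the tree, so the morphism is represented by its determining datum (E-t10's `ArithHolStructure` of §4 is the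
structured counterpart — merge-debt). [claim: Joshi2021ATS1, status: disputed] -/
@[claim "Joshi2021ATS1" "disputed"]
def holDatum (P : PairObj X) : (Y : TemperedCurve p) × (U : Untilt p) × (Y.K →+* U.K) := ⟨P.Y, P.U, P.emb⟩

variable (X)

/-- **Def. 5.11.3 (2) `𝔍(X,E)_E`** (p.31 l.36–38: «the full subcategory … consisting of the objects of the form `(Y/E, (↪ K, K♭ ≃ F))`»,
i.e. with base field `E′ = E`). [claim: Joshi2021ATS1, status: disputed] -/
@[claim "Joshi2021ATS1" "disputed"]
def overBase : Set (PairObj X) := {P | P.Y.K = X.K}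

/-- The pair `(X/E, (E ↪ ℂ_p))` (E-t1's witness `embPadicComplex`). [folklore] -/
def selfPair : PairObj X :=
  ⟨X, Untilt.padicComplex p, ATSObj.embPadicComplex X, ATSObj.continuous_embPadicComplex X, ⟨ContinuousMulEquiv.refl _⟩⟩

/-- «Evidently `(X/E, (↪ K, K♭ ≃ F)) ∈ 𝔍(X,E)_E`» (p.31 l.37–38). [folklore] -/
theorem selfPair_mem_overBase : selfPair X ∈ overBase X := rfl

/-- «… and hence `𝔍(X,E)_E` is not an empty category» (p.31 l.38) — PROVED. [folklore] -/
theorem overBase_nonempty : (overBase X).Nonempty := ⟨selfPair X, selfPair_mem_overBase X⟩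

end PairObj

end ATS1

namespace ATSObj

variable {X : TemperedCurve p}

/-- **Prop. 5.11.2 (1)** (p.31 l.3–7: «a forgetful functor … given by forgetting the geometric base-point»): on E-t1's objects,
forget the label `α` but remember that one exists. [claim: Joshi2021ATS1, status: disputed] -/
@[claim "Joshi2021ATS1" "disputed"]
def toPair (A : ATSObj X) : ATS1.PairObj X := ⟨A.Y, A.U, A.emb, A.continuous_emb, ⟨A.α⟩⟩

/-- Forgetting after labelling is the identity on pairs. [folklore] -/
theorem toPair_withLabel (P : ATS1.PairObj X) (α : P.Y.PiTemp ≃ₜ* X.PiTemp) : (P.withLabel α).toPair = P := by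
  cases P; rfl

/-- Labelling after forgetting, with the object's own label, is the identity on objects. [folklore] -/
theorem withLabel_toPair (A : ATSObj X) : A.toPair.withLabel A.α = A := by
  cases A; rfl

/-- The forgetful functor on isomorphisms. [folklore] -/
def Iso.toPair {A B : ATSObj X} (e : Iso A B) : ATS1.PairObj.Iso A.toPair B.toPair := ⟨e.baseEquiv, e.fieldEquiv, e.emb_comm⟩

/-- Relabelling does not change the underlying pair (the `Aut(Π)`-action moves only the base-point datum). [folklore] -/
theorem toPair_relabel (σ : X.PiTemp ≃ₜ* X.PiTemp) (A : ATSObj X) : (relabel σ A).toPair = A.toPair := rfl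

end ATSObj

/-! ## 2. §5.20: `|𝒳_{F,E}| = |𝒴_{F,E}|/φ^ℤ`; Thm. 5.20.1 (claim shell); Rmk. 5.20.4 -/

namespace UntiltPoints

variable {𝒪E : Type} [CommRing 𝒪E] (D : UntiltPoints p 𝒪E)

/-- The Frobenius-orbit relation on `|𝒴_{F,E}|`: `y ∼ y′` iff `y′ = φ^n(y)` for some `n ∈ ℤ` (§5.20, p.33 l.28–31). [folklore] -/
def frobSetoid : Setoid D.Pt := MulAction.orbitRel (Subgroup.zpowers D.frob) D.Pt

/-- **`|𝒳_{F,E}| := |𝒴_{F,E}|/φ^ℤ`** (J1:§5.20, p.33 l.28–31: «one has a canonical identification `|𝒴_{F,E}|/φ^ℤ ≃ |𝒳_{F,E}|`, given by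
`y ↦ {φ^n(y) : n ∈ ℤ}`», [FF18, Thm. 6.5.2 (4)]) — DEFINED as the orbit quotient of E-t1's point set by its Frobenius; (5.20.2)
`|𝒴_{F,E}| = (𝒢(𝒪_F) − {0})/𝒪_E^*` is E-t1's `ptEquiv`; (5.20.3) `|𝒳_{F,E}| = (𝒢(𝒪_F) − {0})/E^*` is not typed (`E^*` does not act on
E-t1's `G`). [claim: Joshi2021ATS1, status: disputed] -/
@[claim "Joshi2021ATS1" "disputed"]
def XPoints : Type := Quotient D.frobSetoid

/-- The class `{φ^n(y)}` of a point. [folklore] -/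
def toXPoint (y : D.Pt) : D.XPoints := Quotient.mk D.frobSetoid y

/-- `φ(y)` and `y` have the same image in `|𝒳_{F,E}|`. [folklore] -/
theorem toXPoint_frob (y : D.Pt) : D.toXPoint (D.frob y) = D.toXPoint y := by
  apply Quotient.sound
  show MulAction.orbitRel (Subgroup.zpowers D.frob) D.Pt (D.frob y) y
  rw [MulAction.orbitRel_apply]
  exact ⟨⟨D.frob, Subgroup.mem_zpowers _⟩, rfl⟩

/-- `toXPoint` is surjective (every class has a representative). [folklore] -/
theorem toXPoint_surjective : Function.Surjective D.toXPoint := Quotient.mk_surjective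

end UntiltPoints

namespace ATS1

/-- CLAIM SHELL **Thm. 5.20.1** (J1:Thm5.20.1, p.33 l.34–39: «Let `E, E′` be anabelomorphic p-adic fields and let `F` be algebraically
closed perfectoid … Then any anabelomorphism `α : G_E → G_{E′}` induces a homeomorphism of topological spaces compatible with the
respective topological group actions `G_E ↷ |𝒴_{F,E}| ≃ |𝒴_{F,E′}| ↶ G_{E′}` and `G_E ↷ |𝒳_{F,E}| ≃ |𝒳_{F,E′}| ↶ G_{E′}`»; proof via
(5.20.2)/(5.20.3), «`(𝒢(𝒪_F) − {0})` is independent of `E, E′`», `α` inducing `𝒪_E^* ≃ 𝒪_{E′}^*`, `E^* ≃ E′^*`). READING AT BIJECTION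
LEVEL (WEAKER than print): E-t1's `UntiltPoints` carries neither a topology nor a `G_E`-action on `|𝒴_{F,E}|`, so what is typed is
«an isomorphism `G_E ≅ G_{E′}` of the absolute Galois groups (as subgroups of `G_{ℚ_p}`) yields a bijection of the point sets commuting
with Frobenius (hence a bijection of `|𝒳| = |𝒴|/φ^ℤ`)» for point data `D`, `D′` standing for the `E`-, `E′`-untilts (merge-debt E-t1:
topology/action fields). Rmk. 5.20.4 (p.34 l.11–13: «if `E, E′` are strictly anabelomorphic … `𝒳_{F,E}` and `𝒳_{F,E′}` are anabelomorphic
but not isomorphic as schemes» [Joshi 2020b]) is recorded, not typed. HYPOTHESIS, never asserted. [claim: Joshi2021ATS1, status: disputed] -/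
@[claim "Joshi2021ATS1" "disputed"]
def Thm5201 (E E' : IntermediateField ℚ_[p] (AlgebraicClosure ℚ_[p])) {𝒪E 𝒪E' : Type} [CommRing 𝒪E] [CommRing 𝒪E']
    (D : UntiltPoints p 𝒪E) (D' : UntiltPoints p 𝒪E') : Prop :=
  Nonempty (E.fixingSubgroup ≃* E'.fixingSubgroup) → ∃ e : D.Pt ≃ D'.Pt, ∀ y, e (D.frob y) = D'.frob (e y)

/-! ## 3. §5.24: Thm. 5.24.1 — the action of `Aut_{ℤ_p}(𝒢(𝒪_F))` BY CORRESPONDENCES on `𝔍(X,E)_F` -/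

/-- **Thm. 5.24.1 (2), SIGNATURE** (J1:Thm5.24.1(2), p.36 l.8–19: «Let `τ : |𝒴_{F,E′}| → |𝒴_{F,ℚ_p}|` be the finite morphism given by
mapping an `E′`-untilt `y ∈ |𝒴_{F,E′}|` of `F` to the underlying `ℚ_p`-untilt `τ(y) = x ∈ |𝒴_{F,ℚ_p}|` [FF18, Prop. 2.3.20]»), between
E-t1's point data for `E′` (`D'`, the one `𝔍(X,E)_F` is typed over) and for `ℚ_p` (`D`, `𝒪_{ℚ_p} = ℤ_p`): the map `τ` and «underlying
untilt» = the residue fields agree topologically. Its finiteness/fibre count is the claim `TauFibreCard`. [claim: Joshi2021ATS1, status: disputed] -/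
@[claim "Joshi2021ATS1" "disputed"]
structure UnderlyingUntilt {𝒪E' : Type} [CommRing 𝒪E'] (D' : UntiltPoints p 𝒪E') (D : UntiltPoints p ℤ_[p]) : Type where
  /-- `τ : |𝒴_{F,E′}| → |𝒴_{F,ℚ_p}|` -/
  τ : D'.Pt → D.Pt
  /-- `K_{τ(y)} ≅ K_y` topologically: the same untilt with the `E′`-structure forgotten -/
  untilt_τ : ∀ y, (D.untilt (τ y)).TopIso (D'.untilt y)

namespace UnderlyingUntilt

variable {𝒪E' : Type} [CommRing 𝒪E'] {D' : UntiltPoints p 𝒪E'} {D : UntiltPoints p ℤ_[p]} (T : UnderlyingUntilt D' D)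
  {X : TemperedCurve p}

/-- CLAIM (Thm. 5.24.1 (3) + «Moreover», p.36 l.20–21, 28–30: «`τ⁻¹(σ(x)) = {y_1, …, y_m}`», «the number `m = [E′ : ℚ_p]`», [FF18,
Prop. 2.3.20]): every fibre of `τ` is finite with exactly `m` points. HYPOTHESIS, never asserted. [claim: Joshi2021ATS1, status: disputed] -/
@[claim "Joshi2021ATS1" "disputed"]
def TauFibreCard (m : ℕ) : Prop := ∀ x : D.Pt, (T.τ ⁻¹' {x}).Finite ∧ (T.τ ⁻¹' {x}).ncard = m

/-- CLAIM (Thm. 5.24.1 «Moreover», p.36 l.28–33: «`m = [E′ : ℚ_p] = [E : ℚ_p]` depends only on `E` and not on the chosen object of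
`𝔍(X,E)`», «immediate from the fact `E′` and `E` are anabelomorphic p-adic fields, Definition 5.1.1 (4), Proposition 5.8.1»): all
base fields of objects of `𝔍(X,E)` have the degree of `E`. HYPOTHESIS, never asserted (anabelomorphic p-adic fields have equal degree:
[AbsTopIII] Prop. 5.8 (i)-type invariant, not on the cell's FACT-LIST). [claim: Joshi2021ATS1, status: disputed] -/
@[claim "Joshi2021ATS1" "disputed"]
def AnabelomorphicDegreeEq (X : TemperedCurve p) : Prop :=
  ∀ A : ATSObj X, Module.finrank ℚ_[p] A.Y.K = Module.finrank ℚ_[p] X.K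

/-- **The DIVISORIAL CORRESPONDENCE (5.24.2)** of Thm. 5.24.1 (p.36 l.22–27: «`𝔍(X,E)_F ⇢ 𝔍(X,E)_F` is given by the rule
`(Y/E′, y = (E′ ↪ K_y, K♭_y ≃ F)) ↦ ((Y/E′, y_j = (E′ ↪ K_{y_j}, K♭_{y_j} ≃ F)))_{j=1,…,m}`» with `{y_1, …, y_m} = τ⁻¹(σ(x))`, `x = τ(y)`,
`σ ∈ Aut_{ℤ_p}(𝒢(𝒪_F)) ≃ Aut_{ℤ_p}(Ĝ_m(𝒪_F))` ((1), p.36 l.3–7; [J-I] Lem. 10.5.1) acting on `|𝒴_{F,ℚ_p}|` by E-t1's `ptAct`) — DEFINED as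
the SET of objects over the points of `τ⁻¹(σ(τ(y)))` with the same curve and label: a one-to-many map (action «by correspondences»,
p.36 l.1). [claim: Joshi2021ATS1, status: disputed] -/
@[claim "Joshi2021ATS1" "disputed"]
def divCorrespondence (σ : D.Aut) (A : ATSObjF X D') : Set (ATSObjF X D') :=
  {B | ∃ y' : D'.Pt, T.τ y' = D.ptAct σ (T.τ A.pt) ∧ B = { A with pt := y' }}

/-- The correspondence is the image of the fibre `τ⁻¹(σ(τ y))` under `y′ ↦ (Y/E′, y′, α)`. [folklore] -/
theorem divCorrespondence_eq_image (σ : D.Aut) (A : ATSObjF X D') :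
    T.divCorrespondence σ A = (fun y' : D'.Pt => ({ A with pt := y' } : ATSObjF X D')) '' (T.τ ⁻¹' {D.ptAct σ (T.τ A.pt)}) := by
  ext B
  exact ⟨fun ⟨y', hy, hB⟩ => ⟨y', hy, hB.symm⟩, fun ⟨y', hy, hB⟩ => ⟨y', hy, hB.symm⟩⟩

/-- For `σ = 1` the correspondence is the fibre through `A` itself: `A ∈ τ⁻¹(τ(y))`. [folklore] -/
theorem self_mem_divCorrespondence_one (A : ATSObjF X D') : A ∈ T.divCorrespondence 1 A :=
  ⟨A.pt, by rw [UntiltPoints.ptAct_one], rfl⟩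

/-- Every member of the correspondence has the same curve and label as `A` (only the untilt moves). [folklore] -/
theorem Y_eq_of_mem_divCorrespondence {σ : D.Aut} {A B : ATSObjF X D'} (h : B ∈ T.divCorrespondence σ A) : B.Y = A.Y := by
  obtain ⟨y', -, rfl⟩ := h; rfl

/-- Re-pointing an object is injective in the point. [folklore] -/
theorem repoint_injective (A : ATSObjF X D') : Function.Injective fun y' : D'.Pt => ({ A with pt := y' } : ATSObjF X D') :=
  fun _ _ h => congrArg ATSObjF.pt h

/-- **Thm. 5.24.1's count DERIVED modulo `TauFibreCard`**: the correspondence assigns to each object exactly `m = [E′ : ℚ_p]` objects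
(p.36 l.26–29). [folklore] -/
theorem ncard_divCorrespondence {m : ℕ} (hτ : T.TauFibreCard m) (σ : D.Aut) (A : ATSObjF X D') :
    (T.divCorrespondence σ A).ncard = m := by
  rw [divCorrespondence_eq_image, ncard_image_of_injective _ (repoint_injective A)]
  exact (hτ _).2

/-- The correspondence is finite-valued (modulo `TauFibreCard`). [folklore] -/
theorem divCorrespondence_finite {m : ℕ} (hτ : T.TauFibreCard m) (σ : D.Aut) (A : ATSObjF X D') :
    (T.divCorrespondence σ A).Finite := by
  rw [divCorrespondence_eq_image]; exact (hτ _).1.image _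

/-- The moved untilts are all «underlying» the one `ℚ_p`-untilt `σ(τ(y))` (topologically). [folklore] -/
theorem topIso_of_mem_divCorrespondence {σ : D.Aut} {A B : ATSObjF X D'} (h : B ∈ T.divCorrespondence σ A) :
    (D.untilt (D.ptAct σ (T.τ A.pt))).TopIso (D'.untilt B.pt) := by
  obtain ⟨y', hy, rfl⟩ := h
  rw [← hy]
  exact T.untilt_τ y'

end UnderlyingUntilt

end ATS1

end Summit.ABC.IUTFork.Joshi

end
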